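import Mathlib
import HarnessLib
import Summits.HubbardSuperconductivity.HubbardSuperconductivity.Theorems.KLProgrammeKLRegimeEngineV8IsoTupleExportBClosers

/-!
# Route `KLProgramme` — ENGINE child gen 8 (stmt-HubbardSuperconductivity-20437 `KLRegimeEngineV17F2`), class #6 «ISO-MOMENT ROW» text
# (cure «G10-MOM» of the located defect «(X).2-B-FIT-OPAQUE», KL STATUS 2026-08-28 ≈01:12Z; cell gate-hubbard-kl, seat hubbard-kl-k3c2-p2 g14 =
# class-#6 text owner, route (M) M1/M3 owner)

WHY.  The frozen class-#6 export conjunct (X).2-B `∃ e, IsIsoPkgB P klEngGeo9.CF e ∧ IsoTupleLineStepB …` (`…IsoTupleExportB`, rev 9-B) closes only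
through route (M)'s producer, whose U-linear constant is `2¹⁷·c_M` with `c_M` the coefficient of the Λ_m-weighted first moments of the standard iso
tuples of `𝒱ₙ[Kₙ]` (M2); the fit `A + 2(c + c′Klam²u) ≤ CF` then needs `2¹⁸·c_M ≤ CF − 2⁹` NUMERICALLY, while `c_M` is a G-level OPAQUE constant in
this tree (the weighted torus ℓ¹ geometry of the iso-sectorised bare vertex — one momentum derivative more than `IsoTorusBoundAt`/`klIsoT`; cutoff and
sector jets are ∃-constants), exactly the (R47f) situation that created `klE4TF`.  So `CF` must carry `c_M` SYMBOLICALLY, and once the moment constant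
is a deferred package the natural home of M2 is a stub-(b)ₙ ROW (the (E4)ₙ pattern), which dissolves the export conjunct, the deferred class-#6
package, the `∀ G` constraint of the B-step and the §C interleave.  This file is the TEXT of that cure (definitions with bodies, order lemmas, the fit);
`…IsoMomentRowClosers` carries the one-call unroll and the stub-(c) consumer door.

CONTENTS (this file = §1–§2; `…EngineV8DefsG10` = the `raiseCF` door, the explicit class-#6 constants, the fit, the proposed `klEngGeo10`).
* §1 **`IsoFirstMomentsAt L M cM cM′ P β U μ n`** — THE ROW: M2's literal shape (the `hmom` block of `isoTupleLineStepB_of_momentLine` verbatim):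
  for every resolution `n ≤ m ≤ n_β`, every standard iso 4-tuple `ω` at resolution `m`, pin `x₁`, leg `j`,
  `Λ_m · ε³ Σ_y spaceTimeDist(x₁, y_j)·‖klIsoKernelAt … (Kₙ) n m (std ω) (x₁::y)‖ ≤ cM·|U| + cM′·(Klam U)²`; `.mono`, `.hmom` (producer currency).
* §2 **`IsoMomFlowAt E d u`** — the admissibility predicate of a moment package, `E4FlowAt`'s binder list VERBATIM (∀ well-formed `G P R Q`, `cc ≤ klEngC₃6`,
  `U ≤ u G P R Q cc`, β-window, `klEngL₃/klEngM₃`, `1 ≤ n ≤ n_β + 1`, regime, `HistP klPredsV17F2 … G P Q R … 0 n`, `FrameOK (Kₙ)`) with the row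
  `IsoFirstMomentsAt L M E (d P R) P β U μ n` as conclusion — `E` ABSOLUTE (bound first), the quadratic table `d P R` and the threshold free;
  `.mono`; the deferred package **`klIsoMomPack`**, **`klIsoMomC`**, **`klIsoMomD P R`**, **`klIsoMomU G P R Q cc`**, sign rows, `isoMomFlowAt_klIsoMomPack`
  (choose_spec), and the stub-(b) closer line **`isoFirstMomentsAt_flow_of_isoMomFlowAt` / `isoFirstMomentsAt_flow_klIsoMomPack`** (twins of
  `engineFirstMoments_flow_of_e4FlowAt`).  The WITNESS `IsoMomFlowAt E d u` for a concrete package is NOT here: it is W3's output (M2 owners), exactly as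
  `E4FlowAt`'s is.
Definitions with bodies + bookkeeping inequalities; nothing about the model is asserted; nothing asserts superconductivity.
References: BGM 2006 §3 (3.5)–(3.6) (first moments via `∂_{k₀}`) [cite: BenfattoGiulianiMastropietro2006].
-/

noncomputable section

namespace Summit.HubbardSuperconductivity.HubbardSuperconductivity.Theorems.KLRegimeSplit

set_option linter.dupNamespace false -- summit = problem name (single-conjunct summit), D-0017

open Real Finset Literature.MathematicalPhysics.QuantumLattice Literature.Probability.LatticeModels
open Summit.HubbardSuperconductivity.HubbardSuperconductivity.Theorems.KLProgrammeLegKernels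
open Summit.HubbardSuperconductivity.HubbardSuperconductivity.Theorems.DispersionFlow
open Summit.HubbardSuperconductivity.HubbardSuperconductivity.Theorems.EngineV8

/-! ## §1 The row: M2's literal shape as a scale-`n` predicate -/

section Row

variable (L M : ℕ) [NeZero L] [NeZero M]

/-- **`IsoFirstMomentsAt L M cM cM′ P β U μ n`** — the Λ_m-WEIGHTED PINNED FIRST MOMENTS of the standard isotropic 4-tuples of the scale-`n` one-shot
quartic kernel `𝒱ₙ[Kₙ]` at every resolution `n ≤ m ≤ n_β` are `≤ cM·|U| + cM′·(Klam U)²`: for every `ω : Fin 4 → Fin (sectorCount (2m))` (spins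
`(↑,↑,↓,↓)`, charges `(+,−,+,−)`), every pin `x₁` and every leg `j`,
`klScale klE0 m · (ε³ Σ_y spaceTimeDist x₁ (y j) · ‖klIsoKernelAt … (Kₙ) n m (std ω) (x₁::y)‖) ≤ cM·|U| + cM′·(Klam U)²`
— route (M)'s datum M2 (the `hmom` hypothesis of `isoTupleLineStepB_of_momentLine`, with `|U|` for `U`). [cite: BenfattoGiulianiMastropietro2006, §3 (3.5)-(3.6)] -/
def IsoFirstMomentsAt (cM cM' : ℝ) (P : SplitConsts) (β U μ : ℝ) (n : ℕ) : Prop :=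
  ∀ m : ℕ, n ≤ m → m ≤ nScales β → ∀ (ω : Fin 4 → Fin (sectorCount (2 * m))) (x₁ : SpaceTimeIdx L M) (j : Fin 3),
    klScale klE0 m * (imagTimeWeight β M ^ 3 * ∑ y : Fin 3 → SpaceTimeIdx L M,
      spaceTimeDist L M β x₁ (y j) *
        ‖klIsoKernelAt L M β U μ (klFlowFrameU L M β U μ n) n m (fun i => ((ω i, ![(0 : Fin 2), 0, 1, 1] i), ![(0 : Fin 2), 1, 0, 1] i))
          (Matrix.vecCons x₁ y)‖) ≤ cM * |U| + cM' * (P.Klam * U) ^ 2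

variable {L M}

/-- Larger constants are still met. -/
theorem IsoFirstMomentsAt.mono {cM cM₁ cM' cM₁' : ℝ} {P : SplitConsts} {β U μ : ℝ} {n : ℕ} (h : IsoFirstMomentsAt L M cM cM' P β U μ n)
    (hc : cM ≤ cM₁) (hc' : cM' ≤ cM₁') : IsoFirstMomentsAt L M cM₁ cM₁' P β U μ n := by
  intro m hnm hm ω x₁ j
  refine (h m hnm hm ω x₁ j).trans ?_
  have h1 : cM * |U| ≤ cM₁ * |U| := mul_le_mul_of_nonneg_right hc (abs_nonneg U)
  have h2 : cM' * (P.Klam * U) ^ 2 ≤ cM₁' * (P.Klam * U) ^ 2 := mul_le_mul_of_nonneg_right hc' (sq_nonneg _)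
  linarith

/-- **The row in the producer's currency** (`0 ≤ U`): the `hmom` block of `isoTupleLineStepB_of_momentLine` / `isoTupleLineBAt_of_momentLine_numeral`,
with `cM * U` in place of `cM * |U|`. -/
theorem IsoFirstMomentsAt.hmom {cM cM' : ℝ} {P : SplitConsts} {β U μ : ℝ} {n : ℕ} (h : IsoFirstMomentsAt L M cM cM' P β U μ n) (hU : 0 ≤ U) :
    ∀ m : ℕ, n ≤ m → m ≤ nScales β → ∀ (ω : Fin 4 → Fin (sectorCount (2 * m))) (x₁ : SpaceTimeIdx L M) (j : Fin 3),
      klScale klE0 m * (imagTimeWeight β M ^ 3 * ∑ y : Fin 3 → SpaceTimeIdx L M,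
        spaceTimeDist L M β x₁ (y j) *
          ‖klIsoKernelAt L M β U μ (klFlowFrameU L M β U μ n) n m (fun i => ((ω i, ![(0 : Fin 2), 0, 1, 1] i), ![(0 : Fin 2), 1, 0, 1] i))
            (Matrix.vecCons x₁ y)‖) ≤ cM * U + cM' * (P.Klam * U) ^ 2 := by
  intro m hnm hm ω x₁ j
  simpa only [abs_of_nonneg hU] using h m hnm hm ω x₁ j

end Row

end Summit.HubbardSuperconductivity.HubbardSuperconductivity.Theorems.KLRegimeSplit

namespace Summit.HubbardSuperconductivity.HubbardSuperconductivity.Theorems.EngineV8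

set_option linter.dupNamespace false -- summit = problem name (single-conjunct summit), D-0017

open Real Finset Literature.MathematicalPhysics.QuantumLattice Literature.Probability.LatticeModels
open Summit.HubbardSuperconductivity.HubbardSuperconductivity.Theorems.KLRegimeSplit
open Summit.HubbardSuperconductivity.HubbardSuperconductivity.Theorems.KLProgrammeLegKernels
open Summit.HubbardSuperconductivity.HubbardSuperconductivity.Theorems.DispersionFlow

/-! ## §2 The admissibility predicate `IsoMomFlowAt` and the deferred moment package -/

/-- **`IsoMomFlowAt E d u`** — «`(E, d, u)` is an admissible ISO-MOMENT package at the inductive scales of the engine-flow child»: `E4FlowAt`'s binder list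
verbatim — for every well-formed `G`, every well-formed `P`, `R`, `Q` and `0 < cc ≤ klEngC₃6 P R`, under `U ≤ u G P R Q cc`, the `β`-window, the volume
thresholds, the regime, the history `HistP klPredsV17F2 L M G P Q R β U μ 0 n` at the SAME `(G, Q)` and the admissibility of the flow frame — the row
`IsoFirstMomentsAt L M E (d P R) P β U μ n` (`1 ≤ n ≤ nScales β + 1`).
WITNESS SHAPE: `E` is bound before everything — an ABSOLUTE constant (the bare vertex's iso-moment geometry); every `G`-, `P`-, `R`-, `Q`- or
`cc`-dependent part of a moment bound goes into `d P R` (the `(Klam U)²` coefficient) or under the threshold `u G P R Q cc`, never into `E`. -/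
def IsoMomFlowAt (E : ℝ) (d : SplitConsts → RenConsts → ℝ) (u : GeoConsts → SplitConsts → RenConsts → EngConsts → ℝ → ℝ) : Prop :=
  ∀ (G : GeoConsts), G.WF →
    ∀ (P : SplitConsts) (R : RenConsts) (Q : EngConsts) (cc : ℝ), P.WF → R.WF2 → Q.WF → 0 < cc → cc ≤ klEngC₃6 P R →
    ∀ μ ∈ klWindowC, ∀ U : ℝ, 0 < U → U ≤ u G P R Q cc →
    ∀ β : ℝ, klBetaMin ≤ β → β ≤ Real.exp (cc / U ^ 2) →
    ∀ (L M : ℕ) [NeZero L] [NeZero M], klEngL₃ β U ≤ L → klEngM₃ β U L ≤ M →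
    ∀ n : ℕ, 1 ≤ n → n ≤ nScales β + 1 → IsKLRegime U cc (-(n : ℤ)) →
      HistP klPredsV17F2 L M G P Q R β U μ 0 n →
        FrameOK R U (nScales β) μ (klFlowFrameU L M β U μ n) →
          IsoFirstMomentsAt L M E (d P R) P β U μ n

/-- A larger constant, a larger quadratic table and a smaller threshold are still admissible. -/
theorem IsoMomFlowAt.mono {E E' : ℝ} {d d' : SplitConsts → RenConsts → ℝ} {u u' : GeoConsts → SplitConsts → RenConsts → EngConsts → ℝ → ℝ}
    (h : IsoMomFlowAt E d u) (hEE' : E ≤ E') (hdd' : ∀ P R, d P R ≤ d' P R) (huu' : ∀ G P R Q cc, u' G P R Q cc ≤ u G P R Q cc) :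
    IsoMomFlowAt E' d' u' :=
  fun G hG P R Q cc hP hR hQ hcc hcc6 μ hμ U hU hUu β hβ hβc L M _ _ hL hM n hn1 hn hreg hhist hfr =>
    (h G hG P R Q cc hP hR hQ hcc hcc6 μ hμ U hU (hUu.trans (huu' G P R Q cc)) β hβ hβc L M hL hM n hn1 hn hreg hhist hfr).mono hEE' (hdd' P R)

open Classical in
/-- **`klIsoMomPack`** — THE iso-moment package of the engine: an admissible triple `(E, d, u)` with `0 ≤ E`, `0 ≤ d` and `u > 0` pointwise when one
exists, `(0, 0, 1)` otherwise (ONE closed term for all three components, so they come from the same witness). -/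
def klIsoMomPack : ℝ × (SplitConsts → RenConsts → ℝ) × (GeoConsts → SplitConsts → RenConsts → EngConsts → ℝ → ℝ) :=
  if h : (∃ Edu : ℝ × (SplitConsts → RenConsts → ℝ) × (GeoConsts → SplitConsts → RenConsts → EngConsts → ℝ → ℝ),
      0 ≤ Edu.1 ∧ (∀ P R, 0 ≤ Edu.2.1 P R) ∧ (∀ G P R Q cc, 0 < Edu.2.2 G P R Q cc) ∧ IsoMomFlowAt Edu.1 Edu.2.1 Edu.2.2) then Classical.choose h
  else (0, fun _ _ => 0, fun _ _ _ _ _ => 1)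

/-- **`klIsoMomC`** — the ABSOLUTE iso-moment constant (the U-linear coefficient of the row; enters the `G`-package as `CF := CF + 2¹⁸·klIsoMomC`). -/
def klIsoMomC : ℝ := klIsoMomPack.1

/-- **`klIsoMomD P R`** — the iso-moment quadratic table (the `(Klam U)²` coefficient of the row). -/
def klIsoMomD : SplitConsts → RenConsts → ℝ := klIsoMomPack.2.1

/-- **`klIsoMomU G P R Q cc`** — the iso-moment threshold (a DefsU `min` entry, read at the registered `(G, Q)`). -/
def klIsoMomU : GeoConsts → SplitConsts → RenConsts → EngConsts → ℝ → ℝ := klIsoMomPack.2.2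

/-- `0 ≤ klIsoMomC`. -/
theorem klIsoMomC_nonneg : 0 ≤ klIsoMomC := by
  classical
  unfold klIsoMomC klIsoMomPack
  split_ifs with h
  · exact (Classical.choose_spec h).1
  · exact le_rfl

/-- `0 ≤ klIsoMomD P R`. -/
theorem klIsoMomD_nonneg (P : SplitConsts) (R : RenConsts) : 0 ≤ klIsoMomD P R := by
  classical
  unfold klIsoMomD klIsoMomPack
  split_ifs with h
  · exact (Classical.choose_spec h).2.1 P R
  · exact le_rfl

/-- `0 < klIsoMomU G P R Q cc`. -/
theorem klIsoMomU_pos (G : GeoConsts) (P : SplitConsts) (R : RenConsts) (Q : EngConsts) (cc : ℝ) : 0 < klIsoMomU G P R Q cc := by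
  classical
  unfold klIsoMomU klIsoMomPack
  split_ifs with h
  · exact (Classical.choose_spec h).2.2.1 G P R Q cc
  · exact one_pos

/-- **`(klIsoMomC, klIsoMomD, klIsoMomU)` is admissible as soon as any package is** (the form in which W3's witness theorem is consumed). -/
theorem isoMomFlowAt_klIsoMomPack {E : ℝ} {d : SplitConsts → RenConsts → ℝ} {u : GeoConsts → SplitConsts → RenConsts → EngConsts → ℝ → ℝ}
    (hE0 : 0 ≤ E) (hd : ∀ P R, 0 ≤ d P R) (hu : ∀ G P R Q cc, 0 < u G P R Q cc) (hE : IsoMomFlowAt E d u) :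
    IsoMomFlowAt klIsoMomC klIsoMomD klIsoMomU := by
  classical
  have h : ∃ Edu : ℝ × (SplitConsts → RenConsts → ℝ) × (GeoConsts → SplitConsts → RenConsts → EngConsts → ℝ → ℝ),
      0 ≤ Edu.1 ∧ (∀ P R, 0 ≤ Edu.2.1 P R) ∧ (∀ G P R Q cc, 0 < Edu.2.2 G P R Q cc) ∧ IsoMomFlowAt Edu.1 Edu.2.1 Edu.2.2 :=
    ⟨(E, d, u), hE0, hd, hu, hE⟩
  have hp : klIsoMomPack = Classical.choose h := by unfold klIsoMomPack; exact dif_pos h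
  have h1 : klIsoMomC = (Classical.choose h).1 := by unfold klIsoMomC; rw [hp]
  have h2 : klIsoMomD = (Classical.choose h).2.1 := by unfold klIsoMomD; rw [hp]
  have h3 : klIsoMomU = (Classical.choose h).2.2 := by unfold klIsoMomU; rw [hp]
  rw [h1, h2, h3]
  exact (Classical.choose_spec h).2.2.2

/-- **Consumer form** (stub (b)'s closer line for the row): from any witness `IsoMomFlowAt E d u` (`0 ≤ E`, `0 ≤ d`, `u > 0`), at every well-formed
`G` and `Q`, under the v2 binders (`U ≤ klIsoMomU G P R Q cc` among the thresholds): `IsoFirstMomentsAt L M klIsoMomC (klIsoMomD P R) P β U μ n`. -/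
theorem isoFirstMomentsAt_flow_of_isoMomFlowAt {E : ℝ} {d : SplitConsts → RenConsts → ℝ}
    {u : GeoConsts → SplitConsts → RenConsts → EngConsts → ℝ → ℝ} (hE0 : 0 ≤ E) (hd : ∀ P R, 0 ≤ d P R) (hu : ∀ G P R Q cc, 0 < u G P R Q cc)
    (hE : IsoMomFlowAt E d u)
    (G : GeoConsts) (hG : G.WF) (P : SplitConsts) (R : RenConsts) (Q : EngConsts) (cc : ℝ) (hP : P.WF) (hR : R.WF2)
    (hQ : Q.WF) (hcc : 0 < cc) (hcc6 : cc ≤ klEngC₃6 P R) (μ : ℝ) (hμ : μ ∈ klWindowC) (U : ℝ) (hU : 0 < U) (hUu : U ≤ klIsoMomU G P R Q cc)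
    (β : ℝ) (hβ : klBetaMin ≤ β) (hβc : β ≤ Real.exp (cc / U ^ 2)) (L M : ℕ) [NeZero L] [NeZero M]
    (hL : klEngL₃ β U ≤ L) (hM : klEngM₃ β U L ≤ M) (n : ℕ) (hn1 : 1 ≤ n) (hn : n ≤ nScales β + 1) (hreg : IsKLRegime U cc (-(n : ℤ)))
    (hhist : HistP klPredsV17F2 L M G P Q R β U μ 0 n) (hfr : FrameOK R U (nScales β) μ (klFlowFrameU L M β U μ n)) :
    IsoFirstMomentsAt L M klIsoMomC (klIsoMomD P R) P β U μ n :=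
  isoMomFlowAt_klIsoMomPack hE0 hd hu hE G hG P R Q cc hP hR hQ hcc hcc6 μ hμ U hU hUu β hβ hβc L M hL hM n hn1 hn hreg hhist hfr

/-- The same with the engine's `klEngL₄ P R` volume door (`klEngL₃ ≤ klEngL₄`). -/
theorem isoFirstMomentsAt_flow_klIsoMomPack {E : ℝ} {d : SplitConsts → RenConsts → ℝ}
    {u : GeoConsts → SplitConsts → RenConsts → EngConsts → ℝ → ℝ} (hE0 : 0 ≤ E) (hd : ∀ P R, 0 ≤ d P R) (hu : ∀ G P R Q cc, 0 < u G P R Q cc)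
    (hE : IsoMomFlowAt E d u)
    (G : GeoConsts) (hG : G.WF) (P : SplitConsts) (R : RenConsts) (Q : EngConsts) (cc : ℝ) (hP : P.WF) (hR : R.WF2)
    (hQ : Q.WF) (hcc : 0 < cc) (hcc6 : cc ≤ klEngC₃6 P R) (μ : ℝ) (hμ : μ ∈ klWindowC) (U : ℝ) (hU : 0 < U) (hUu : U ≤ klIsoMomU G P R Q cc)
    (β : ℝ) (hβ : klBetaMin ≤ β) (hβc : β ≤ Real.exp (cc / U ^ 2)) (L M : ℕ) [NeZero L] [NeZero M]
    (hL : klEngL₄ P R β U ≤ L) (hM : klEngM₃ β U L ≤ M) (n : ℕ) (hn1 : 1 ≤ n) (hn : n ≤ nScales β + 1) (hreg : IsKLRegime U cc (-(n : ℤ)))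
    (hhist : HistP klPredsV17F2 L M G P Q R β U μ 0 n) (hfr : FrameOK R U (nScales β) μ (klFlowFrameU L M β U μ n)) :
    IsoFirstMomentsAt L M klIsoMomC (klIsoMomD P R) P β U μ n :=
  isoFirstMomentsAt_flow_of_isoMomFlowAt hE0 hd hu hE G hG P R Q cc hP hR hQ hcc hcc6 μ hμ U hU hUu β hβ hβc L M (klEngL₃_le_of_klEngL₄_le hL)
    hM n hn1 hn hreg hhist hfr

end Summit.HubbardSuperconductivity.HubbardSuperconductivity.Theorems.EngineV8

end
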